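import Mathlib

/-!
# K2 lane (route-2 `SawtoothPulseCascade`, crux dir `K1LocalisedCascade`): Parseval for the transverse Fourier coefficients — transport cannot create energy beyond enstrophy/a²

Helper file of the K2 lane (ACL item stmt-AnomalousDissipation-19491; E6-b / E2 of the S4 line, arbiter A27-1 (iii) «P2-E6»). p4's transverse
coefficient of a lamination state with interior `g` and no sheets is `ĝ(n) = ∫_{−½}^{½} g(y) e^{−2πi(β+n)y} dy` (`K2ConeSketch.coeff`), its energy on the
line of streamwise wavenumber `a` is `Σ_n |ĝ(n)|²/(4π²(a² + (β+n)²))` (`energy`). For ANY continuous bounded interior — in particular a mode profile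
multiplied by the unimodular transport phase `e^{−2πiaθ·tri(y)}` (the H/V slot's transported content, `hTransport`/`vTransport`) — Parseval on
`(−½, ½]` (`tsum_sq_fourierCoeffOn`) gives `Σ_n |ĝ(n)|² = ∫_{−½}^{½} |g|²` (`hasSum_sq_coeff`), hence **`energy ≤ (∫|g|²)/(4π²a²)`**
(`tsum_energy_le`): transport, which preserves `∫|g|²` (enstrophy of the line), amplifies the energy of content of transverse wavenumber `|ξ| ≤ U·a`
by at most `1 + U²` (the Orr bound, `energy_gain_le`). No definitions; no statement about the crux. [folklore] [problem: turb]
-/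

-- `Summit.<Summit>.<Problem>`: single-conjunct summit, the duplicate namespace segment is deliberate.
set_option linter.dupNamespace false

noncomputable section

namespace Summit.AnomalousDissipation.AnomalousDissipation.Theorems.SawtoothPulseCascade.K2PhaseBudget

open Set MeasureTheory intervalIntegral

/-- p4's transverse coefficient with Bloch phase `β` IS the `fourierCoeffOn (−½,½]` of `g·e^{−2πiβy}`. [folklore] -/
theorem fourierCoeffOn_eq_coeff (g : ℝ → ℂ) (β : ℝ) (n : ℤ) :
    fourierCoeffOn (by norm_num : (-(1 / 2 : ℝ)) < 1 / 2) (fun y => g y * Complex.exp (-((2 * Real.pi * β * y : ℝ) : ℂ) * Complex.I)) n =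
      ∫ y in (-(1 / 2 : ℝ))..(1 / 2), g y * Complex.exp (-(2 * Real.pi * (β + n) * y : ℝ) * Complex.I) := by
  rw [fourierCoeffOn_eq_integral]
  have hT : (1 / 2 : ℝ) - -(1 / 2) = 1 := by norm_num
  rw [hT, one_div_one, one_smul]
  refine intervalIntegral.integral_congr fun y _ => ?_
  simp only [smul_eq_mul]
  rw [fourier_coe_apply, mul_left_comm, ← Complex.exp_add]
  congr 2
  push_cast
  ring

/-- **Parseval for p4's coefficients:** `Σ_n |ĝ(n)|² = ∫_{−½}^{½} |g|²` for a continuous interior `g`. [folklore] -/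
theorem hasSum_sq_coeff {g : ℝ → ℂ} (hg : Continuous g) (β : ℝ) :
    HasSum (fun n : ℤ => ‖∫ y in (-(1 / 2 : ℝ))..(1 / 2), g y * Complex.exp (-(2 * Real.pi * (β + n) * y : ℝ) * Complex.I)‖ ^ 2)
      (∫ y in (-(1 / 2 : ℝ))..(1 / 2), ‖g y‖ ^ 2) := by
  have hab : (-(1 / 2 : ℝ)) < 1 / 2 := by norm_num
  set f : ℝ → ℂ := fun y => g y * Complex.exp (-((2 * Real.pi * β * y : ℝ) : ℂ) * Complex.I) with hf
  have hfc : Continuous f := by rw [hf]; fun_prop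
  obtain ⟨C, hC⟩ := (isCompact_Icc (a := -(1 / 2 : ℝ)) (b := 1 / 2)).exists_bound_of_continuousOn hfc.continuousOn
  have hL2 : MemLp f 2 (volume.restrict (Ioc (-(1 / 2 : ℝ)) (1 / 2))) := by
    refine MemLp.of_bound hfc.aestronglyMeasurable C ?_
    rw [ae_restrict_iff' measurableSet_Ioc]
    exact Filter.Eventually.of_forall fun y hy => hC y (Ioc_subset_Icc_self hy)
  have h := hasSum_sq_fourierCoeffOn hab hL2
  simp_rw [hf, fourierCoeffOn_eq_coeff] at h
  have hT : ((1 / 2 : ℝ) - -(1 / 2))⁻¹ = 1 := by norm_num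
  rw [hT, one_smul] at h
  have hn : ∀ y : ℝ, ‖g y * Complex.exp (-((2 * Real.pi * β * y : ℝ) : ℂ) * Complex.I)‖ ^ 2 = ‖g y‖ ^ 2 := by
    intro y
    rw [norm_mul, show -((2 * Real.pi * β * y : ℝ) : ℂ) * Complex.I = ((-(2 * Real.pi * β * y) : ℝ) : ℂ) * Complex.I by push_cast; ring,
      Complex.norm_exp_ofReal_mul_I, mul_one]
  simp_rw [hn] at h
  exact h

/-- **Energy ≤ enstrophy/a²:** `Σ_n |ĝ(n)|²/(4π²(a²+(β+n)²)) ≤ (∫_{−½}^{½}|g|²)/(4π²a²)` (`a ≠ 0`), with summability. [folklore] -/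
theorem tsum_energy_le {g : ℝ → ℂ} (hg : Continuous g) (β : ℝ) {a : ℝ} (ha : a ≠ 0) :
    Summable (fun n : ℤ => ‖∫ y in (-(1 / 2 : ℝ))..(1 / 2), g y * Complex.exp (-(2 * Real.pi * (β + n) * y : ℝ) * Complex.I)‖ ^ 2 /
        (4 * Real.pi ^ 2 * (a ^ 2 + (β + n) ^ 2))) ∧
    ∑' n : ℤ, ‖∫ y in (-(1 / 2 : ℝ))..(1 / 2), g y * Complex.exp (-(2 * Real.pi * (β + n) * y : ℝ) * Complex.I)‖ ^ 2 /
        (4 * Real.pi ^ 2 * (a ^ 2 + (β + n) ^ 2)) ≤ (∫ y in (-(1 / 2 : ℝ))..(1 / 2), ‖g y‖ ^ 2) / (4 * Real.pi ^ 2 * a ^ 2) := by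
  have hP := hasSum_sq_coeff hg β
  have ha2 : 0 < a ^ 2 := by positivity
  have hw : ∀ n : ℤ, ‖∫ y in (-(1 / 2 : ℝ))..(1 / 2), g y * Complex.exp (-(2 * Real.pi * (β + n) * y : ℝ) * Complex.I)‖ ^ 2 /
        (4 * Real.pi ^ 2 * (a ^ 2 + (β + n) ^ 2)) ≤
      ‖∫ y in (-(1 / 2 : ℝ))..(1 / 2), g y * Complex.exp (-(2 * Real.pi * (β + n) * y : ℝ) * Complex.I)‖ ^ 2 / (4 * Real.pi ^ 2 * a ^ 2) := by
    intro n
    apply div_le_div_of_nonneg_left (sq_nonneg _) (by positivity)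
    have := sq_nonneg (β + n)
    nlinarith [Real.pi_pos]
  have hS : Summable fun n : ℤ => ‖∫ y in (-(1 / 2 : ℝ))..(1 / 2), g y * Complex.exp (-(2 * Real.pi * (β + n) * y : ℝ) * Complex.I)‖ ^ 2 /
      (4 * Real.pi ^ 2 * a ^ 2) := hP.summable.div_const _
  have hS' : Summable fun n : ℤ => ‖∫ y in (-(1 / 2 : ℝ))..(1 / 2), g y * Complex.exp (-(2 * Real.pi * (β + n) * y : ℝ) * Complex.I)‖ ^ 2 /
      (4 * Real.pi ^ 2 * (a ^ 2 + (β + n) ^ 2)) :=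
    Summable.of_nonneg_of_le (fun n => by positivity) hw hS
  refine ⟨hS', ?_⟩
  calc _ ≤ ∑' n : ℤ, ‖∫ y in (-(1 / 2 : ℝ))..(1 / 2), g y * Complex.exp (-(2 * Real.pi * (β + n) * y : ℝ) * Complex.I)‖ ^ 2 /
        (4 * Real.pi ^ 2 * a ^ 2) := hS'.tsum_le_tsum hw hS
    _ = (∫ y in (-(1 / 2 : ℝ))..(1 / 2), ‖g y‖ ^ 2) / (4 * Real.pi ^ 2 * a ^ 2) := by rw [tsum_div_const, hP.tsum_eq]

/-- **The Orr bound for unimodular content:** if `|g| ≤ 1` pointwise (a transverse mode times the transport phase), the line energy is `≤ 1/(4π²a²)`,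
i.e. at most `(a² + ξ²)/a² = 1 + (ξ/a)²` times the energy `1/(4π²(a²+ξ²))` of the bare mode `e^{2πiξy}`. [folklore] -/
theorem energy_gain_le {g : ℝ → ℂ} (hg : Continuous g) (hb : ∀ y, ‖g y‖ ≤ 1) (β : ℝ) {a : ℝ} (ha : a ≠ 0) :
    ∑' n : ℤ, ‖∫ y in (-(1 / 2 : ℝ))..(1 / 2), g y * Complex.exp (-(2 * Real.pi * (β + n) * y : ℝ) * Complex.I)‖ ^ 2 /
        (4 * Real.pi ^ 2 * (a ^ 2 + (β + n) ^ 2)) ≤ 1 / (4 * Real.pi ^ 2 * a ^ 2) := by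
  refine (tsum_energy_le hg β ha).2.trans (div_le_div_of_nonneg_right ?_ (by positivity))
  have h1 : ∫ y in (-(1 / 2 : ℝ))..(1 / 2), ‖g y‖ ^ 2 ≤ ∫ y in (-(1 / 2 : ℝ))..(1 / 2), (1 : ℝ) := by
    apply intervalIntegral.integral_mono_on (by norm_num)
    · exact (by fun_prop : Continuous fun y => ‖g y‖ ^ 2).intervalIntegrable _ _
    · exact intervalIntegrable_const
    · intro y _
      have := hb y
      have h0 := norm_nonneg (g y)
      nlinarith
  rw [intervalIntegral.integral_const, smul_eq_mul, mul_one] at h1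
  norm_num at h1
  exact h1

end Summit.AnomalousDissipation.AnomalousDissipation.Theorems.SawtoothPulseCascade.K2PhaseBudget

end
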